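import Summits.AnomalousDissipation.AnomalousDissipation.Theorems.MarginalStabilityChainStrainedLayerLawClockStubNegEnstrophyLawE

/-!
# Stub `stub_negEnstrophyLaw` of line `FirstLemmasR2K4` (log-enstrophy clock; crux `MarginalStabilityChain.StrainedLayerLaw`,
# stmt-AnomalousDissipation-3007) — PROVED

Support file (`--supports stmt-AnomalousDissipation-3007`) proving the registered stub `stub_negEnstrophyLaw` with its
signature verbatim: GIVEN that the zero set of every `C¹` plane function carries no gradient almost everywhere (the
statement of the neighbouring stub `stub_levelSetNull`, taken as hypothesis), along every classical solution
`(u, v, p)` of the stretched two-dimensional Navier–Stokes layer system on `(0, ∞)` (`ν, L > 0`) with uniform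
exponential shear tails on compact time intervals, the enstrophy of the NEGATIVE vorticity
`Ω₋(t) = ∫_{(0,L]}∫_ℝ ω₋²` (`ω₋ = max(−ω, 0)`, `ω = ∂ₓv − ∂_yu`) is differentiable on `t > 0` with

  `Ω₋′(t) = Ω₋(t) − 2ν P₋(t)`,  `P₋ = ∫∫ 1_{ω<0}|∇ω|²`

(no interface term from `{ω = 0}`). Route (the `F(s) = s₋²` analogue of the Kato / enstrophy chain of p120637):
the weak vorticity balance `∂ₜω + div(ω(u, v − y)) = νΔω` (tools D of p120637) is tested against `F_ε′(ω)ψ_{1/ε}` with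
the `C²` convex regularisation `F_ε(s) = (s² − s√(s² + ε²))/2 → s₋²` (tools A) and the cutoff `ψ_R` (tools F of
p120637): tools B (renormalised balance at one instant), C (continuity / differentiation in time under the integral),
D (the balance integrated on `[s, t′]` at level `ε`, with the cutoff-transition terms `O(ε)` by the tails), E (removal
of `ε` at one instant by dominated convergence; the hypothesis kills the term `F_ε″(ω)|∇ω|²` on `{ω = 0}` in the
limit). This file: dominated convergence in time gives the integral identity `Ω₋(t′) − Ω₋(s) = ∫_s^{t′}(Ω₋ − 2νP₋)`
(`clock_negEnstrophy_identity`); `t ↦ Ω₋(t) − 2νP₋(t)` is continuous on `(0, ∞)` (`clock_negEnstrophy_continuousOn`: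
dominated convergence, with almost-everywhere continuity in time of `1_{ω<0}|∇ω|²` off the null set
`{ω(t₀) = 0, ∇ω(t₀) ≠ 0}`); the fundamental theorem of calculus concludes. All `[folklore]` (renormalised enstrophy
balances for 2-D Navier–Stokes: e.g. Ben-Artzi, Arch. Rational Mech. Anal. 128 (1994); Majda–Bertozzi 2002 §1.4 for
the stretched class).
-/

-- `Summit.<Summit>.<Problem>` is the tree's mandated summit-side namespace (CONVENTIONS §2); for this
-- single-conjunct summit the two coincide, so the duplicate is deliberate.
set_option linter.dupNamespace false

noncomputable section

open scoped Topology ENNReal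
open Filter Set Function MeasureTheory

namespace Summit.AnomalousDissipation.AnomalousDissipation.Theorems.StrainedLayerLaw.LogEnstrophyClock

open Literature.Analysis.FluidPDE Literature.Analysis.FluidPDE.StretchedLayer
open Summit.AnomalousDissipation.AnomalousDissipation.Theses.MarginalStabilityChain
open Summit.AnomalousDissipation.AnomalousDissipation.Theorems.StrainedLayerLaw.StrainWorkSumRule

/-! ## The integral identity `Ω₋(t′) − Ω₋(s) = ∫_s^{t′} (Ω₋ − 2νP₋)` -/

section Identity

variable {ν L : ℝ} {u v p : ℝ → ℝ → ℝ → ℝ}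

/-- **The negative-enstrophy balance in integral form.** Under the null-zero-set hypothesis, along a classical
solution with shear tails on compact time intervals, `Ω₋(t′) − Ω₋(s) = ∫_s^{t′} (Ω₋(τ) − 2νP₋(τ)) dτ` for
`0 < s ≤ t′` (tools D at level `ε` with cutoff `ψ_{1/ε}`; `ε → 0⁺` by tools E at each instant and dominated
convergence in time; the error is `O(ε)`). [folklore] -/
theorem clock_negEnstrophy_identity
    (hNull : ∀ (f : ℝ → ℝ → ℝ), ContDiff ℝ 1 (fun q : ℝ × ℝ => f q.1 q.2) →
      volume {q : ℝ × ℝ | f q.1 q.2 = 0 ∧ (dX f q.1 q.2 ≠ 0 ∨ dY f q.1 q.2 ≠ 0)} = 0)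
    (hν : 0 < ν) (hL : 0 < L) (hsol : IsStretchedLayerNSSolutionOn (Ioi 0) ν 1 1 L u v p)
    (htails : ∀ a b : ℝ, 0 < a → a < b → ExpTails (Icc a b) u v) {s t' : ℝ} (hs : 0 < s) (hst : s ≤ t') :
    negEnstrophy L (u t') (v t') - negEnstrophy L (u s) (v s) =
      ∫ τ in s..t', (negEnstrophy L (u τ) (v τ) - 2 * ν * negPalinstrophy L (u τ) (v τ)) := by
  obtain ⟨C, k, hk, hCk⟩ := htails (s / 2) (t' + 1) (by positivity) (by linarith)
  have hST : ∀ τ ∈ Icc s t', SliceTails C k (u τ) (v τ) := fun τ hτ =>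
    (hCk τ ⟨by linarith [hτ.1], by linarith [hτ.2]⟩).1
  obtain ⟨Cσ, hCσ0, hCσ⟩ := kato_smoothTransition_deriv_bound
  have hpos : ∀ {τ : ℝ}, τ ∈ Icc s t' → 0 < τ := fun hτ => hs.trans_le hτ.1
  have hu2 : ∀ {τ : ℝ}, 0 < τ → ContDiff ℝ 2 (fun q : ℝ × ℝ => u τ q.1 q.2) := fun hτ => hsol.contDiff_u (mem_Ioi.2 hτ)
  have hv2 : ∀ {τ : ℝ}, 0 < τ → ContDiff ℝ 2 (fun q : ℝ × ℝ => v τ q.1 q.2) := fun hτ => hsol.contDiff_v (mem_Ioi.2 hτ)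
  have hdiv : ∀ {τ : ℝ}, 0 < τ → ∀ x y, dX (u τ) x y + dY (v τ) x y = 0 := fun hτ => hsol.divFree _ (mem_Ioi.2 hτ)
  have hIsub : uIoc s t' ⊆ Ioi 0 := fun τ hτ => by rw [uIoc_of_le hst] at hτ; exact hs.trans hτ.1
  -- the weights and the strip functionals
  set IW : ℝ := ∫ q in Ioc 0 L ×ˢ univ, (C + |q.2|) * Real.exp (-k * |q.2|) with hIW
  set Ik : ℝ := ∫ q in Ioc 0 L ×ˢ univ, Real.exp (-k * |q.2|) with hIk
  set ψq : ℝ → ℝ → ℝ := fun ε y => Real.smoothTransition (2 - y / ε⁻¹) * Real.smoothTransition (2 + y / ε⁻¹) with hψq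
  set N : ℝ → ℝ → ℝ := fun ε τ => ∫ q in Ioc 0 L ×ˢ univ,
    (vorticity (u τ) (v τ) q.1 q.2 ^ 2 - vorticity (u τ) (v τ) q.1 q.2 *
      Real.sqrt (vorticity (u τ) (v τ) q.1 q.2 ^ 2 + ε ^ 2)) / 2 * ψq ε q.2 with hN
  set A : ℝ → ℝ → ℝ := fun ε τ => ∫ q in Ioc 0 L ×ˢ univ, (vorticity (u τ) (v τ) q.1 q.2 *
      (vorticity (u τ) (v τ) q.1 q.2 - Real.sqrt (vorticity (u τ) (v τ) q.1 q.2 ^ 2 + ε ^ 2) / 2 -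
        vorticity (u τ) (v τ) q.1 q.2 * (vorticity (u τ) (v τ) q.1 q.2 /
          Real.sqrt (vorticity (u τ) (v τ) q.1 q.2 ^ 2 + ε ^ 2)) / 2) -
      (vorticity (u τ) (v τ) q.1 q.2 ^ 2 - vorticity (u τ) (v τ) q.1 q.2 *
        Real.sqrt (vorticity (u τ) (v τ) q.1 q.2 ^ 2 + ε ^ 2)) / 2) * ψq ε q.2 with hA
  set Cc : ℝ → ℝ → ℝ := fun ε τ => ∫ q in Ioc 0 L ×ˢ univ,
    (1 - vorticity (u τ) (v τ) q.1 q.2 / Real.sqrt (vorticity (u τ) (v τ) q.1 q.2 ^ 2 + ε ^ 2) -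
      vorticity (u τ) (v τ) q.1 q.2 * (ε ^ 2 / ((vorticity (u τ) (v τ) q.1 q.2 ^ 2 + ε ^ 2) *
        Real.sqrt (vorticity (u τ) (v τ) q.1 q.2 ^ 2 + ε ^ 2))) / 2) *
      (dX (vorticity (u τ) (v τ)) q.1 q.2 ^ 2 + dY (vorticity (u τ) (v τ)) q.1 q.2 ^ 2) * ψq ε q.2 with hCc
  set Ωs : ℝ → ℝ := fun τ => ∫ q in Ioc 0 L ×ˢ univ, (max (-(vorticity (u τ) (v τ) q.1 q.2)) 0) ^ 2 with hΩs
  set Ps : ℝ → ℝ := fun τ => ∫ q in Ioc 0 L ×ˢ univ, (if vorticity (u τ) (v τ) q.1 q.2 < 0 then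
    dX (vorticity (u τ) (v τ)) q.1 q.2 ^ 2 + dY (vorticity (u τ) (v τ)) q.1 q.2 ^ 2 else 0) with hPs
  -- (1) the level identity, for every `ε > 0`
  have hlevel : ∀ ε : ℝ, 0 < ε → |N ε t' - N ε s - ∫ τ in s..t', (A ε τ - ν * Cc ε τ)| ≤
      (t' - s) * (2 * Cσ * ε * (C + ε) * C * (IW + 2 * ν * Ik)) := by
    intro ε hε
    have hR : 0 < ε⁻¹ := inv_pos.2 hε
    have h := stub_negEnstrophyLaw_level ν L u v p (fun r => (r ^ 2 - r * Real.sqrt (r ^ 2 + ε ^ 2)) / 2)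
      (fun r => r - Real.sqrt (r ^ 2 + ε ^ 2) / 2 - r * (r / Real.sqrt (r ^ 2 + ε ^ 2)) / 2)
      (fun r => 1 - r / Real.sqrt (r ^ 2 + ε ^ 2) - r * (ε ^ 2 / ((r ^ 2 + ε ^ 2) * Real.sqrt (r ^ 2 + ε ^ 2))) / 2)
      (ψq ε) ε ε⁻¹ (2 * Cσ / ε⁻¹) C k s t' hsol hν.le hL (clock_F_hasDerivAt hε) (clock_Fp_hasDerivAt hε)
      (clock_Fp_contDiff hε) (clock_Fpp_continuous hε) hε.le (clock_F_abs_le hε) (clock_Fp_abs_le hε)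
      (kato_cutoff_contDiff ε⁻¹) (kato_cutoff_abs_le_one ε⁻¹) (fun y hy => kato_cutoff_eq_zero hR hy)
      (kato_cutoff_deriv_bound hR hCσ) (fun y hy => kato_cutoff_deriv_eq_zero_of_gt hR hy) hk hs hst hST
    refine h.trans_eq ?_
    rw [div_inv_eq_mul]
  -- (2) the error tends to zero
  have herr : Tendsto (fun ε : ℝ => (t' - s) * (2 * Cσ * ε * (C + ε) * C * (IW + 2 * ν * Ik))) (𝓝[>] 0) (𝓝 0) := by
    have hc : Continuous fun ε : ℝ => (t' - s) * (2 * Cσ * ε * (C + ε) * C * (IW + 2 * ν * Ik)) := by fun_prop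
    have h := hc.tendsto 0
    simp only [mul_zero, zero_mul, add_zero] at h
    exact h.mono_left nhdsWithin_le_nhds
  have hΦ0 : Tendsto (fun ε : ℝ => N ε t' - N ε s - ∫ τ in s..t', (A ε τ - ν * Cc ε τ)) (𝓝[>] 0) (𝓝 0) := by
    refine squeeze_zero_norm' ?_ herr
    filter_upwards [self_mem_nhdsWithin] with ε hε
    rw [Real.norm_eq_abs]
    exact hlevel ε hε
  -- (3) the limits of the three pieces
  have hN : ∀ {τ : ℝ}, τ ∈ Icc s t' → Tendsto (fun ε : ℝ => N ε τ) (𝓝[>] 0) (𝓝 (Ωs τ)) := fun {τ} hτ =>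
    clock_limit_N hk (hST τ hτ) (hu2 (hpos hτ)) (hv2 (hpos hτ))
  have hInt : Tendsto (fun ε : ℝ => ∫ τ in s..t', (A ε τ - ν * Cc ε τ)) (𝓝[>] 0)
      (𝓝 (∫ τ in s..t', (Ωs τ - ν * (2 * Ps τ)))) := by
    refine intervalIntegral.tendsto_integral_filter_of_dominated_convergence
      (fun _ => C ^ 2 * Ik + ν * (4 * C ^ 2 * Ik)) ?_ ?_ intervalIntegrable_const ?_
    · filter_upwards [self_mem_nhdsWithin] with ε hε
      have hε' : (0:ℝ) < ε := hε
      have hR : 0 < ε⁻¹ := inv_pos.2 hε'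
      have hAc := clock_continuousOn_A hsol.contDiffOn_u hsol.contDiffOn_v (clock_F_continuous ε)
        (clock_Fp_continuous hε') (kato_cutoff_contDiff ε⁻¹).continuous (fun y hy => kato_cutoff_eq_zero hR hy) L
      have hCc' := clock_continuousOn_C hsol.contDiffOn_u hsol.contDiffOn_v (clock_Fpp_continuous hε')
        (kato_cutoff_contDiff ε⁻¹).continuous (fun y hy => kato_cutoff_eq_zero hR hy) L
      exact ((hAc.sub (continuousOn_const.mul hCc')).mono hIsub).aestronglyMeasurable measurableSet_uIoc
    · filter_upwards [self_mem_nhdsWithin] with ε hε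
      have hε' : (0:ℝ) < ε := hε
      refine Eventually.of_forall fun τ hτ => ?_
      rw [uIoc_of_le hst] at hτ
      have hτI : τ ∈ Icc s t' := ⟨hτ.1.le, hτ.2⟩
      have hτ0 : 0 < τ := hpos hτI
      have h1 : |A ε τ| ≤ C ^ 2 * Ik := clock_A_abs_le hk (hST τ hτI) hε' ε⁻¹
      have h2 : |Cc ε τ| ≤ 4 * C ^ 2 * Ik := clock_C_abs_le hk (hST τ hτI) (hu2 hτ0) (hv2 hτ0) (hdiv hτ0) hε' ε⁻¹
      rw [Real.norm_eq_abs]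
      calc |A ε τ - ν * Cc ε τ| ≤ |A ε τ| + |ν * Cc ε τ| := abs_sub _ _
        _ = |A ε τ| + ν * |Cc ε τ| := by rw [abs_mul, abs_of_pos hν]
        _ ≤ C ^ 2 * Ik + ν * (4 * C ^ 2 * Ik) := add_le_add h1 (mul_le_mul_of_nonneg_left h2 hν.le)
    · refine Eventually.of_forall fun τ hτ => ?_
      rw [uIoc_of_le hst] at hτ
      have hτI : τ ∈ Icc s t' := ⟨hτ.1.le, hτ.2⟩
      have hτ0 : 0 < τ := hpos hτI
      have hnullτ := hNull (vorticity (u τ) (v τ)) (contDiff_one_vorticity (hu2 hτ0) (hv2 hτ0))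
      have hA' : Tendsto (fun ε : ℝ => A ε τ) (𝓝[>] 0) (𝓝 (Ωs τ)) := clock_limit_A hk (hST τ hτI) (hu2 hτ0) (hv2 hτ0)
      have hC' : Tendsto (fun ε : ℝ => Cc ε τ) (𝓝[>] 0) (𝓝 (2 * Ps τ)) :=
        clock_limit_C hk (hST τ hτI) (hu2 hτ0) (hv2 hτ0) (hdiv hτ0) hnullτ
      exact hA'.sub (hC'.const_mul ν)
  have hΦlim : Tendsto (fun ε : ℝ => N ε t' - N ε s - ∫ τ in s..t', (A ε τ - ν * Cc ε τ)) (𝓝[>] 0)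
      (𝓝 (Ωs t' - Ωs s - ∫ τ in s..t', (Ωs τ - ν * (2 * Ps τ)))) :=
    ((hN ⟨hst, le_rfl⟩).sub (hN ⟨le_rfl, hst⟩)).sub hInt
  have heq := tendsto_nhds_unique hΦlim hΦ0
  -- (4) back to the iterated functionals of the line
  have eΩ : ∀ τ ∈ Icc s t', negEnstrophy L (u τ) (v τ) = Ωs τ := fun τ hτ =>
    clock_negEnstrophy_eq_strip hk (hST τ hτ) (hu2 (hpos hτ)) (hv2 (hpos hτ))
  have eP : ∀ τ ∈ Icc s t', negPalinstrophy L (u τ) (v τ) = Ps τ := fun τ hτ =>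
    clock_negPalinstrophy_eq_strip hk (hST τ hτ) (hu2 (hpos hτ)) (hv2 (hpos hτ)) (hdiv (hpos hτ))
  have eI : ∫ τ in s..t', (negEnstrophy L (u τ) (v τ) - 2 * ν * negPalinstrophy L (u τ) (v τ)) =
      ∫ τ in s..t', (Ωs τ - ν * (2 * Ps τ)) := by
    refine intervalIntegral.integral_congr fun τ hτ => ?_
    rw [uIcc_of_le hst] at hτ
    rw [eΩ τ hτ, eP τ hτ]
    ring
  rw [eΩ t' ⟨hst, le_rfl⟩, eΩ s ⟨le_rfl, hst⟩, eI]
  linarith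

end Identity

/-! ## Continuity in time of `Ω₋ − 2νP₋` -/

section Continuity

variable {ν L : ℝ} {u v p : ℝ → ℝ → ℝ → ℝ}

/-- `max(−s, 0)² ≤ s²`. [folklore] -/
theorem clock_negPart_sq_le (s : ℝ) : (max (-s) 0) ^ 2 ≤ s ^ 2 := by
  rcases le_or_gt 0 (-s) with h | h
  · rw [max_eq_left h]; ring_nf; exact le_rfl
  · rw [max_eq_right h.le, zero_pow two_ne_zero]; exact sq_nonneg _

/-- **Continuity of `t ↦ Ω₋(t) − 2νP₋(t)` on `(0, ∞)`.** Under the null-zero-set hypothesis, along a classical solution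
with shear tails on compact time intervals: `Ω₋` is continuous by dominated convergence (`ω` is jointly continuous,
`ω₋² ≤ C²e^{−k|y|}`); `P₋` is continuous at `t₀` by dominated convergence (`|∇ω|² ≤ 2C²e^{−k|y|}`) with almost-everywhere
continuity in time of `1_{ω<0}|∇ω|²`: where `ω(t₀) ≠ 0` the indicator is eventually constant, where
`ω(t₀) = 0 = ∇ω(t₀)` the integrand is squeezed to `0`, and the remaining points form the null set
`{ω(t₀) = 0, ∇ω(t₀) ≠ 0}`. [folklore] -/
theorem clock_negEnstrophy_continuousOn
    (hNull : ∀ (f : ℝ → ℝ → ℝ), ContDiff ℝ 1 (fun q : ℝ × ℝ => f q.1 q.2) →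
      volume {q : ℝ × ℝ | f q.1 q.2 = 0 ∧ (dX f q.1 q.2 ≠ 0 ∨ dY f q.1 q.2 ≠ 0)} = 0)
    (hsol : IsStretchedLayerNSSolutionOn (Ioi 0) ν 1 1 L u v p)
    (htails : ∀ a b : ℝ, 0 < a → a < b → ExpTails (Icc a b) u v) :
    ContinuousOn (fun τ => negEnstrophy L (u τ) (v τ) - 2 * ν * negPalinstrophy L (u τ) (v τ)) (Ioi 0) := by
  intro t₀ ht₀
  have ht₀' : 0 < t₀ := ht₀
  refine ContinuousAt.continuousWithinAt ?_
  obtain ⟨C, k, hk, hCk⟩ := htails (t₀ / 2) (t₀ + 1) (by positivity) (by linarith)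
  have hI : t₀ ∈ Ioo (t₀ / 2) (t₀ + 1) := ⟨by linarith, by linarith⟩
  have hST : ∀ τ ∈ Ioo (t₀ / 2) (t₀ + 1), SliceTails C k (u τ) (v τ) := fun τ hτ => (hCk τ ⟨hτ.1.le, hτ.2.le⟩).1
  have hC : 0 ≤ C := (hST t₀ hI).nonneg
  have hpos : ∀ {τ : ℝ}, τ ∈ Ioo (t₀ / 2) (t₀ + 1) → 0 < τ := fun hτ => lt_trans (by positivity) hτ.1
  have hu2 : ∀ {τ : ℝ}, 0 < τ → ContDiff ℝ 2 (fun q : ℝ × ℝ => u τ q.1 q.2) := fun hτ => hsol.contDiff_u (mem_Ioi.2 hτ)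
  have hv2 : ∀ {τ : ℝ}, 0 < τ → ContDiff ℝ 2 (fun q : ℝ × ℝ => v τ q.1 q.2) := fun hτ => hsol.contDiff_v (mem_Ioi.2 hτ)
  have hdiv : ∀ {τ : ℝ}, 0 < τ → ∀ x y, dX (u τ) x y + dY (v τ) x y = 0 := fun hτ => hsol.divFree _ (mem_Ioi.2 hτ)
  have hW := kato_continuousOn_vorticity_spacetime hsol.contDiffOn_u hsol.contDiffOn_v
  have hX := clock_continuousOn_dX_vorticity_spacetime hsol.contDiffOn_u hsol.contDiffOn_v
  have hY := clock_continuousOn_dY_vorticity_spacetime hsol.contDiffOn_u hsol.contDiffOn_v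
  have cω : ∀ {τ : ℝ}, 0 < τ → Continuous fun q : ℝ × ℝ => vorticity (u τ) (v τ) q.1 q.2 := fun hτ =>
    (contDiff_one_vorticity (hu2 hτ) (hv2 hτ)).continuous
  have hSm : MeasurableSet (Ioc (0:ℝ) L ×ˢ (univ : Set ℝ)) := measurableSet_Ioc.prod MeasurableSet.univ
  -- `Ω₋` in strip form is continuous at `t₀`
  have hΩ : ContinuousAt (fun τ => ∫ q in Ioc 0 L ×ˢ univ, (max (-(vorticity (u τ) (v τ) q.1 q.2)) 0) ^ 2) t₀ := by
    refine continuousAt_of_dominated (μ := volume.restrict (Ioc 0 L ×ˢ univ))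
      (bound := fun q => C ^ 2 * Real.exp (-k * |q.2|)) ?_ ?_ ?_ ?_
    · filter_upwards [Ioo_mem_nhds hI.1 hI.2] with τ hτ
      exact (((cω (hpos hτ)).neg.max continuous_const).pow 2).aestronglyMeasurable
    · filter_upwards [Ioo_mem_nhds hI.1 hI.2] with τ hτ
      refine Eventually.of_forall fun q => ?_
      rw [Real.norm_eq_abs, abs_of_nonneg (sq_nonneg _)]
      exact (clock_negPart_sq_le _).trans (clock_vorticity_sq_le hk (hST τ hτ) q.1 q.2)
    · exact (kato_integrableOn_weight hk L).const_mul _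
    · refine Eventually.of_forall fun q => ?_
      have h1 := clock_continuousAt_time hW ht₀' q
      exact ((continuous_neg.max continuous_const).pow 2).continuousAt.comp h1
  -- `P₋` in strip form is continuous at `t₀`
  have hP : ContinuousAt (fun τ => ∫ q in Ioc 0 L ×ˢ univ, (if vorticity (u τ) (v τ) q.1 q.2 < 0 then
      dX (vorticity (u τ) (v τ)) q.1 q.2 ^ 2 + dY (vorticity (u τ) (v τ)) q.1 q.2 ^ 2 else 0)) t₀ := by
    refine continuousAt_of_dominated (μ := volume.restrict (Ioc 0 L ×ˢ univ))
      (bound := fun q => 2 * C ^ 2 * Real.exp (-k * |q.2|)) ?_ ?_ ?_ ?_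
    · filter_upwards [Ioo_mem_nhds hI.1 hI.2] with τ hτ
      exact (clock_measurable_negPal (contDiff_one_vorticity (hu2 (hpos hτ)) (hv2 (hpos hτ)))).aestronglyMeasurable
    · filter_upwards [Ioo_mem_nhds hI.1 hI.2] with τ hτ
      refine Eventually.of_forall fun q => ?_
      rw [Real.norm_eq_abs]
      split_ifs
      · rw [abs_of_nonneg (by positivity)]
        exact clock_grad_vorticity_sq_le hk (hST τ hτ) (hu2 (hpos hτ)) (hv2 (hpos hτ)) (hdiv (hpos hτ)) q.1 q.2
      · rw [abs_zero]; positivity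
    · exact (kato_integrableOn_weight hk L).const_mul _
    · have hnull := hNull (vorticity (u t₀) (v t₀)) (contDiff_one_vorticity (hu2 ht₀') (hv2 ht₀'))
      have hae := measure_eq_zero_iff_ae_notMem.1 hnull
      filter_upwards [ae_restrict_of_ae (s := Ioc 0 L ×ˢ univ) hae] with q hq
      have hq' : vorticity (u t₀) (v t₀) q.1 q.2 = 0 →
          dX (vorticity (u t₀) (v t₀)) q.1 q.2 = 0 ∧ dY (vorticity (u t₀) (v t₀)) q.1 q.2 = 0 := by
        intro h0
        by_contra hc
        exact hq ⟨h0, not_and_or.1 hc⟩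
      have hWc : ContinuousAt (fun τ => vorticity (u τ) (v τ) q.1 q.2) t₀ := clock_continuousAt_time hW ht₀' q
      have hXc : ContinuousAt (fun τ => dX (vorticity (u τ) (v τ)) q.1 q.2) t₀ := clock_continuousAt_time hX ht₀' q
      have hYc : ContinuousAt (fun τ => dY (vorticity (u τ) (v τ)) q.1 q.2) t₀ := clock_continuousAt_time hY ht₀' q
      have hPc : ContinuousAt (fun τ => dX (vorticity (u τ) (v τ)) q.1 q.2 ^ 2 + dY (vorticity (u τ) (v τ)) q.1 q.2 ^ 2)
          t₀ := (hXc.pow 2).add (hYc.pow 2)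
      rcases lt_trichotomy (vorticity (u t₀) (v t₀) q.1 q.2) 0 with hneg | hzero | hpos'
      · have hev : ∀ᶠ τ in 𝓝 t₀, vorticity (u τ) (v τ) q.1 q.2 < 0 := hWc.eventually (Iio_mem_nhds hneg)
        refine hPc.congr_of_eventuallyEq ?_
        filter_upwards [hev] with τ hτ
        rw [if_pos hτ]
      · obtain ⟨hx, hy⟩ := hq' hzero
        have h0 : dX (vorticity (u t₀) (v t₀)) q.1 q.2 ^ 2 + dY (vorticity (u t₀) (v t₀)) q.1 q.2 ^ 2 = 0 := by
          rw [hx, hy]; ring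
        have hPt : Tendsto (fun τ => dX (vorticity (u τ) (v τ)) q.1 q.2 ^ 2 + dY (vorticity (u τ) (v τ)) q.1 q.2 ^ 2)
            (𝓝 t₀) (𝓝 0) := by
          have h := hPc.tendsto; rwa [h0] at h
        have hval : (if vorticity (u t₀) (v t₀) q.1 q.2 < 0 then
            dX (vorticity (u t₀) (v t₀)) q.1 q.2 ^ 2 + dY (vorticity (u t₀) (v t₀)) q.1 q.2 ^ 2 else 0) = (0:ℝ) := by
          rw [if_neg (by rw [hzero]; exact lt_irrefl 0)]
        have hlim : Tendsto (fun τ => if vorticity (u τ) (v τ) q.1 q.2 < 0 then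
            dX (vorticity (u τ) (v τ)) q.1 q.2 ^ 2 + dY (vorticity (u τ) (v τ)) q.1 q.2 ^ 2 else 0) (𝓝 t₀) (𝓝 0) := by
          refine tendsto_of_tendsto_of_tendsto_of_le_of_le tendsto_const_nhds hPt (fun τ => ?_) (fun τ => ?_)
          · show (0:ℝ) ≤ _
            split_ifs <;> positivity
          · show _ ≤ dX (vorticity (u τ) (v τ)) q.1 q.2 ^ 2 + dY (vorticity (u τ) (v τ)) q.1 q.2 ^ 2
            split_ifs
            · exact le_rfl
            · positivity
        have key : Tendsto (fun τ => if vorticity (u τ) (v τ) q.1 q.2 < 0 then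
            dX (vorticity (u τ) (v τ)) q.1 q.2 ^ 2 + dY (vorticity (u τ) (v τ)) q.1 q.2 ^ 2 else 0) (𝓝 t₀)
            (𝓝 (if vorticity (u t₀) (v t₀) q.1 q.2 < 0 then
              dX (vorticity (u t₀) (v t₀)) q.1 q.2 ^ 2 + dY (vorticity (u t₀) (v t₀)) q.1 q.2 ^ 2 else 0)) := by
          rw [hval]; exact hlim
        exact key
      · have hev : ∀ᶠ τ in 𝓝 t₀, 0 < vorticity (u τ) (v τ) q.1 q.2 := hWc.eventually (Ioi_mem_nhds hpos')
        refine (continuousAt_const (y := (0:ℝ))).congr_of_eventuallyEq ?_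
        filter_upwards [hev] with τ hτ
        rw [if_neg (not_lt.2 hτ.le)]
  -- combine and return to the iterated functionals
  have hstrip := hΩ.sub (hP.const_mul (2 * ν))
  refine hstrip.congr_of_eventuallyEq ?_
  filter_upwards [Ioo_mem_nhds hI.1 hI.2] with τ hτ
  rw [clock_negEnstrophy_eq_strip hk (hST τ hτ) (hu2 (hpos hτ)) (hv2 (hpos hτ)),
    clock_negPalinstrophy_eq_strip hk (hST τ hτ) (hu2 (hpos hτ)) (hv2 (hpos hτ)) (hdiv (hpos hτ))]
  rfl

end Continuity

/-! ## The stub -/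

/-- **Stub B1 — THE NEGATIVE-ENSTROPHY LAW (registered stub `stub_negEnstrophyLaw` of line `FirstLemmasR2K4`).** GIVEN
that the zero set of every `C¹` plane function carries no gradient almost everywhere (the neighbouring stub
`stub_levelSetNull`, taken as hypothesis), along every classical solution of the stretched layer class on `(0, ∞)`
(`ν, L > 0`) with shear tails on compact time intervals, `t ↦ Ω₋(t)` is differentiable on `t > 0` with
`Ω₋′(t) = Ω₋(t) − 2νP₋(t)`: the integral identity `Ω₋(t′) − Ω₋(t/2) = ∫_{t/2}^{t′}(Ω₋ − 2νP₋)`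
(`clock_negEnstrophy_identity`), the continuity of the integrand on `(0, ∞)` (`clock_negEnstrophy_continuousOn`) and
the fundamental theorem of calculus (`intervalIntegral.integral_hasDerivAt_right`). [folklore] -/
theorem stub_negEnstrophyLaw :
    (∀ (f : ℝ → ℝ → ℝ), ContDiff ℝ 1 (fun q : ℝ × ℝ => f q.1 q.2) →
      volume {q : ℝ × ℝ | f q.1 q.2 = 0 ∧ (dX f q.1 q.2 ≠ 0 ∨ dY f q.1 q.2 ≠ 0)} = 0) →
    ∀ (ν L : ℝ), 0 < ν → 0 < L → ∀ (u v p : ℝ → ℝ → ℝ → ℝ),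
      IsStretchedLayerNSSolutionOn (Ioi 0) ν 1 1 L u v p →
      (∀ a b : ℝ, 0 < a → a < b → ExpTails (Icc a b) u v) →
        ∀ t : ℝ, 0 < t → HasDerivAt (fun s => negEnstrophy L (u s) (v s))
          (negEnstrophy L (u t) (v t) - 2 * ν * negPalinstrophy L (u t) (v t)) t := by
  intro hNull ν L hν hL u v p hsol htails t ht
  set g : ℝ → ℝ := fun τ => negEnstrophy L (u τ) (v τ) - 2 * ν * negPalinstrophy L (u τ) (v τ) with hg
  have hgc : ContinuousOn g (Ioi 0) := clock_negEnstrophy_continuousOn hNull hsol htails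
  have ht2 : 0 < t / 2 := by positivity
  have hsub : uIcc (t / 2) t ⊆ Ioi 0 := fun τ hτ => by
    rw [uIcc_of_le (by linarith)] at hτ; exact ht2.trans_le hτ.1
  have hint : IntervalIntegrable g volume (t / 2) t := (hgc.mono hsub).intervalIntegrable
  have hmeas : StronglyMeasurableAtFilter g (𝓝 t) volume :=
    ContinuousOn.stronglyMeasurableAtFilter isOpen_Ioi hgc t ht
  have hcont : ContinuousAt g t := hgc.continuousAt (Ioi_mem_nhds ht)
  have h1 : HasDerivAt (fun t' => ∫ τ in (t / 2)..t', g τ) (g t) t :=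
    intervalIntegral.integral_hasDerivAt_right hint hmeas hcont
  have h2 : HasDerivAt (fun t' => negEnstrophy L (u (t / 2)) (v (t / 2)) + ∫ τ in (t / 2)..t', g τ) (g t) t :=
    h1.const_add _
  refine h2.congr_of_eventuallyEq ?_
  filter_upwards [Ioi_mem_nhds (show t / 2 < t by linarith)] with t' ht'
  have hid := clock_negEnstrophy_identity hNull hν hL hsol htails ht2 (le_of_lt ht')
  simp only [hg]
  linarith

end Summit.AnomalousDissipation.AnomalousDissipation.Theorems.StrainedLayerLaw.LogEnstrophyClock

end
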